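import Literature.Geometry.Riemannian.CalabiStrongMaximumPrinciple
import Literature.Geometry.Riemannian.BochnerRicciInequality
import Literature.Geometry.Riemannian.WeightedHeatFlowFromLinearHeat
import Literature.Geometry.Riemannian.CheegerColdingExcessEstimate
import Literature.Geometry.Lorentzian.CurvatureSymmetries
import Literature.Geometry.Riemannian.EllipticMaximumPrincipleClosed
import Mathlib.Analysis.SpecialFunctions.SmoothTransition
import Mathlib.Algebra.QuadraticDiscriminant
import HarnessLib

/-!
# The Cheng–Yau local gradient estimate for positive harmonic functions

S.-Y. Cheng, S.-T. Yau, *Differential equations on Riemannian manifolds and their geometric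
applications*, Comm. Pure Appl. Math. 28 (1975) 333–354, Thm. 6 (with S.-T. Yau, CPAM 28
(1975) 201–228); R. Schoen, S.-T. Yau, *Lectures on Differential Geometry*, Ch. I, Thm. 3.1;
P. Li, *Geometric Analysis*, Thm. 6.1. On a connected Riemannian `m`-manifold with complete
Levi-Civita connection and `Ric ≥ -(m-1)`, a smooth function `u > 0` which is harmonic on the
ball `B_R(p)` satisfies

  `sup_{B_{R/2}(p)} |∇ log u|² ≤ C(m) (1 + 1/R)²`

(`chengYau_gradient_estimate`; `C(m)` depends only on `m` — through `m` and the derivative bounds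
of one fixed smooth cutoff profile). Proof as printed (Yau's maximum principle computation):
`φ = log u`, `Q = |∇φ|²`, `Δφ = -Q` on the ball; Bochner's inequality
(`dalembertian_gradSq_ge_of_ricci_ge`) gives `ΔQ ≥ (2/m)Q² + 2⟨dφ, dΔφ⟩ - 2(m-1)Q`; at an interior
maximum `x₀` of `G = χ(ρ/R)² Q` (`ρ = d_p`; when `x₀` lies on the cut locus of `p`, Calabi's
trick `exists_smooth_upper_barrier_edist` replaces `ρ` by the smooth upper barrier `δ + d_q`,
touching at `x₀`), the conditions `d log G̃ = 0` (`mvfderiv_eq_zero_of_isLocalMax`),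
`Δ log G̃ ≤ 0`, the eikonal equation and the
Laplacian comparison `Δ d_q ≤ (m-1) coth` yield the bound. No definitions, no named facts
(D-0026). Groundwork for `CheegerColding1997_sphereStability` (Cheeger–Colding 1996, §1, §6:
gradient bounds for the harmonic comparison functions).

## References

* S.-Y. Cheng, S.-T. Yau, Comm. Pure Appl. Math. 28 (1975) 333–354, Thm. 6. [ChengYau1975]
* R. Schoen, S.-T. Yau, *Lectures on Differential Geometry* (1994), Ch. I, Thm. 3.1.
* J. Cheeger, T. H. Colding, Ann. of Math. 144 (1996) 189–237, §1. [CheegerColding1996]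
-/

noncomputable section

open Bundle Set Function Filter
open scoped Manifold ContDiff Topology ENNReal NNReal Real

namespace Literature.Geometry.Riemannian

open Lorentzian Lorentzian.PseudoRiemannianMetric

/-! ### §0 Real-variable helpers and the cutoff profile -/

section RealHelpers

/-- `x ≤ c √x + d` (`x ≥ 0`) forces `x ≤ c² + 2d`. [folklore] -/
theorem le_sq_add_two_mul_of_le_mul_sqrt_add {x c d : ℝ} (hx : 0 ≤ x)
    (h : x ≤ c * Real.sqrt x + d) : x ≤ c ^ 2 + 2 * d := by
  have hs := Real.sq_sqrt hx
  nlinarith [sq_nonneg (Real.sqrt x - c), Real.sqrt_nonneg x]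

/-- **A smooth cutoff profile with `χ'² ≤ A₁²`, `|χ''| ≤ A₂`**: `χ = 1` on `(-∞, 1/2]`, `χ = 0` on
`[1, ∞)`, `0 ≤ χ ≤ 1`, `χ > 0` on `(-∞, 1)`, `χ` nonincreasing and `C^∞` with globally bounded
first and second derivatives (`χ(t) = smoothTransition (2 - 2t)`). [folklore] -/
theorem exists_smooth_cutoff_profile :
    ∃ χ : ℝ → ℝ, ∃ A₁ A₂ : ℝ, 0 ≤ A₁ ∧ 0 ≤ A₂ ∧ ContDiff ℝ 2 χ ∧
      (∀ t, t ≤ 1 / 2 → χ t = 1) ∧ (∀ t, 1 ≤ t → χ t = 0) ∧ (∀ t, 0 ≤ χ t) ∧ (∀ t, χ t ≤ 1) ∧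
      (∀ t, t < 1 → 0 < χ t) ∧ Antitone χ ∧
      (∀ t, |deriv χ t| ≤ A₁) ∧ (∀ t, deriv χ t ≤ 0) ∧ (∀ t, |deriv (deriv χ) t| ≤ A₂) := by
  set χ : ℝ → ℝ := fun t ↦ Real.smoothTransition (2 - 2 * t) with hχ
  have hsm : ContDiff ℝ ∞ χ := by
    rw [hχ]; exact Real.smoothTransition.contDiff.comp (contDiff_const.sub (contDiff_const.mul contDiff_id))
  have hanti : Antitone χ := fun s t hst ↦
    Real.smoothTransition.monotone (by linarith)
  -- bounded derivatives: continuous, and zero outside `[0, 2]`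
  have hd1 : Continuous (deriv χ) := hsm.continuous_deriv (by norm_cast)
  have hd2 : Continuous (deriv (deriv χ)) := by
    have h2 : ContDiff ℝ 1 (deriv χ) := by
      have h3 : ContDiff ℝ (1 + 1) χ := hsm.of_le (by norm_cast)
      simpa using h3.iterate_deriv' 1 1
    exact h2.continuous_deriv le_rfl
  obtain ⟨A₁, hA₁⟩ := (isCompact_Icc (a := (-1 : ℝ)) (b := 2)).exists_bound_of_continuousOn hd1.continuousOn
  obtain ⟨A₂, hA₂⟩ := (isCompact_Icc (a := (-1 : ℝ)) (b := 2)).exists_bound_of_continuousOn hd2.continuousOn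
  -- outside `[0, 3/2]` the function is locally constant
  have hconst_lo : ∀ t, t < 1 / 2 → deriv χ =ᶠ[𝓝 t] fun _ ↦ 0 := by
    intro t ht
    have hev : ∀ᶠ s in 𝓝 t, χ s = 1 := by
      filter_upwards [eventually_lt_nhds ht] with s hs
      exact Real.smoothTransition.one_of_one_le (by linarith)
    have hev2 : ∀ᶠ s in 𝓝 t, χ =ᶠ[𝓝 s] fun _ ↦ (1 : ℝ) := eventually_eventually_nhds.2 hev
    filter_upwards [hev2] with s hs
    rw [hs.deriv_eq, deriv_const]
  have hconst_hi : ∀ t, 1 < t → deriv χ =ᶠ[𝓝 t] fun _ ↦ 0 := by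
    intro t ht
    have hev : ∀ᶠ s in 𝓝 t, χ s = 0 := by
      filter_upwards [eventually_gt_nhds ht] with s hs
      exact Real.smoothTransition.zero_of_nonpos (by linarith)
    have hev2 : ∀ᶠ s in 𝓝 t, χ =ᶠ[𝓝 s] fun _ ↦ (0 : ℝ) := eventually_eventually_nhds.2 hev
    filter_upwards [hev2] with s hs
    rw [hs.deriv_eq, deriv_const]
  have hder_out : ∀ t, t ∉ Icc (-1 : ℝ) 2 → deriv χ t = 0 ∧ deriv (deriv χ) t = 0 := by
    intro t ht
    simp only [mem_Icc, not_and_or, not_le] at ht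
    rcases ht with h | h
    · have h1 := hconst_lo t (by linarith)
      exact ⟨h1.eq_of_nhds, by rw [h1.deriv_eq, deriv_const]⟩
    · have h1 := hconst_hi t (by linarith)
      exact ⟨h1.eq_of_nhds, by rw [h1.deriv_eq, deriv_const]⟩
  have hA₁0 : 0 ≤ A₁ := (norm_nonneg _).trans (hA₁ 0 (by norm_num [mem_Icc]))
  have hA₂0 : 0 ≤ A₂ := (norm_nonneg _).trans (hA₂ 0 (by norm_num [mem_Icc]))
  refine ⟨χ, A₁, A₂, hA₁0, hA₂0, hsm.of_le (by norm_cast), ?_, ?_, ?_, ?_, ?_, hanti, ?_, ?_, ?_⟩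
  · intro t ht; exact Real.smoothTransition.one_of_one_le (by linarith)
  · intro t ht; exact Real.smoothTransition.zero_of_nonpos (by linarith)
  · intro t; exact Real.smoothTransition.nonneg _
  · intro t; exact Real.smoothTransition.le_one _
  · intro t ht; exact Real.smoothTransition.pos_of_pos (by linarith)
  · intro t
    by_cases ht : t ∈ Icc (-1 : ℝ) 2
    · simpa [Real.norm_eq_abs] using hA₁ t ht
    · rw [(hder_out t ht).1, abs_zero]; exact hA₁0
  · intro t; exact hanti.deriv_nonpos
  · intro t
    by_cases ht : t ∈ Icc (-1 : ℝ) 2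
    · simpa [Real.norm_eq_abs] using hA₂ t ht
    · rw [(hder_out t ht).2, abs_zero]; exact hA₂0

end RealHelpers

/-! ### §0' Manifold helpers -/

section ManifoldHelpers

variable {E : Type*} [NormedAddCommGroup E] [NormedSpace ℝ E] [FiniteDimensional ℝ E]
  [CompleteSpace E] {M : Type*} [TopologicalSpace M] [ChartedSpace E M] [IsManifold 𝓘(ℝ, E) ∞ M]
  [T2Space M]
  (g : PseudoRiemannianMetric 𝓘(ℝ, E) ∞ E (TangentSpace 𝓘(ℝ, E) : M → Type _)) [g.HasLeviCivita]
  [CovariantDerivative.ContMDiffCovariantDerivative g.leviCivita 1]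
  [CovariantDerivative.ContMDiffCovariantDerivative g.leviCivita ∞]

omit [CompleteSpace E] [T2Space M] [g.HasLeviCivita]
  [CovariantDerivative.ContMDiffCovariantDerivative g.leviCivita 1]
  [CovariantDerivative.ContMDiffCovariantDerivative g.leviCivita ∞] in
/-- **Cauchy–Schwarz for the inverse metric** `|g⁻¹(α, β)| ≤ √g⁻¹(α,α) √g⁻¹(β,β)` for a
Riemannian `g` (discriminant of `s ↦ g⁻¹(α + sβ, α + sβ) ≥ 0`). [folklore] -/
theorem abs_innerDual_le_sqrt_mul_sqrt (hg : g.IsRiemannian) (x : M)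
    (α β : Module.Dual ℝ (TangentSpace 𝓘(ℝ, E) x)) :
    |g.innerDual x α β| ≤ Real.sqrt (g.innerDual x α α) * Real.sqrt (g.innerDual x β β) := by
  set A := g.innerDual x α α with hA
  set B := g.innerDual x α β with hB
  set C := g.innerDual x β β with hC
  have hA0 : 0 ≤ A := g.innerDual_self_nonneg hg x α
  have hC0 : 0 ≤ C := g.innerDual_self_nonneg hg x β
  have hquad : ∀ s : ℝ, 0 ≤ C * (s * s) + 2 * B * s + A := fun s ↦ by
    have h := g.innerDual_self_nonneg hg x (α + s • β)
    rw [g.innerDual_add_smul_self x α β s] at h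
    nlinarith
  have hdisc := discrim_le_zero hquad
  rw [discrim] at hdisc
  have hB2 : B ^ 2 ≤ A * C := by nlinarith
  rw [← Real.sqrt_mul hA0, ← Real.sqrt_sq_eq_abs]
  exact Real.sqrt_le_sqrt (by nlinarith)

omit [CompleteSpace E] [T2Space M] [g.HasLeviCivita]
  [CovariantDerivative.ContMDiffCovariantDerivative g.leviCivita 1]
  [CovariantDerivative.ContMDiffCovariantDerivative g.leviCivita ∞] in
/-- **`|∇(ζ ∘ u)|² = ζ'(u)² |∇u|²`** (`d(ζ ∘ u) = ζ'(u) du`). [folklore] -/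
theorem gradSq_comp_real_eq_deriv_sq_mul {u : M → ℝ} {ζ : ℝ → ℝ} {x : M} (hζ : DifferentiableAt ℝ ζ (u x))
    (hu : MDifferentiableAt 𝓘(ℝ, E) 𝓘(ℝ, ℝ) u x) :
    g.gradSq (ζ ∘ u) x = deriv ζ (u x) ^ 2 * g.gradSq u x := by
  have hd : mvfderiv 𝓘(ℝ, E) (ζ ∘ u) x = deriv ζ (u x) • mvfderiv 𝓘(ℝ, E) u x := by
    ext v
    rw [mvfderiv_real_comp hζ hu v, FunLike.coe_smul, Pi.smul_apply, smul_eq_mul]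
  simp only [PseudoRiemannianMetric.gradSq, hd, ContinuousLinearMap.toLinearMap_smul, map_smul,
    LinearMap.smul_apply, smul_eq_mul, PseudoRiemannianMetric.innerDual]
  ring

end ManifoldHelpers

/-! ### §1 The scalar inequality at the maximum point -/

section Arith

/-- The real-variable heart of Yau's maximum principle computation: from the first/second
order conditions at the maximum point (`h1`), Bochner's inequality (`h2`) and the cutoff
bounds, `ζ₀ Q₀ ≤ (2 m A₁/R)² + 2(m² + 4 m A₁²/R² + m A₂/R² + m A₁ Λ/R)`. [folklore] -/
theorem chengYau_arith {m Q₀ ζ₀ ζ₁ ζ₂ L Λ P D A₁ A₂ R : ℝ} (hm : 0 < m) (hQ : 0 < Q₀)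
    (hζ₀ : 0 < ζ₀) (hζ₀1 : ζ₀ ≤ 1) (hR : 0 < R) (hA₁ : 0 ≤ A₁) (hΛ : 0 ≤ Λ) (hL : L ≤ Λ)
    (hζ₁0 : ζ₁ ≤ 0) (hζ₁a : |ζ₁| ≤ 2 * A₁ / R * Real.sqrt ζ₀) (hζ₁b : |ζ₁| ≤ 2 * A₁ / R)
    (hζ₁sq : ζ₁ ^ 2 ≤ 4 * A₁ ^ 2 / R ^ 2 * ζ₀) (hζ₂ : -(2 * A₂ / R ^ 2) ≤ ζ₂)
    (hP : |P| ≤ Real.sqrt Q₀)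
    (h1 : D / Q₀ - ζ₁ ^ 2 / ζ₀ ^ 2 + (ζ₂ / ζ₀ - ζ₁ ^ 2 / ζ₀ ^ 2) + ζ₁ / ζ₀ * L ≤ 0)
    (h2 : 2 / m * Q₀ ^ 2 + 2 * (Q₀ * ζ₁ / ζ₀) * P - 2 * (m - 1) * Q₀ ≤ D) :
    ζ₀ * Q₀ ≤ (2 * m * A₁ / R) ^ 2 +
      2 * (m ^ 2 + 4 * m * A₁ ^ 2 / R ^ 2 + m * A₂ / R ^ 2 + m * A₁ * Λ / R) := by
  set X : ℝ := ζ₀ * Q₀ with hX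
  have hX0 : 0 < X := mul_pos hζ₀ hQ
  -- atoms
  set a : ℝ := ζ₁ ^ 2 / ζ₀ ^ 2 with ha
  set b : ℝ := ζ₂ / ζ₀ with hb
  set c : ℝ := ζ₁ / ζ₀ with hc
  -- divide Bochner by `Q₀`, combine with `h1`, multiply by `ζ₀`
  have h3 : 2 / m * Q₀ + 2 * c * P - 2 * (m - 1) ≤ D / Q₀ := by
    rw [le_div_iff₀ hQ]
    have : (2 / m * Q₀ + 2 * c * P - 2 * (m - 1)) * Q₀ =
        2 / m * Q₀ ^ 2 + 2 * (Q₀ * ζ₁ / ζ₀) * P - 2 * (m - 1) * Q₀ := by rw [hc]; ring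
    rw [this]; exact h2
  have h1' : D / Q₀ - a + (b - a) + c * L ≤ 0 := h1
  have h4 : 2 / m * Q₀ + 2 * c * P - 2 * (m - 1) ≤ 2 * a - b - c * L := by linarith
  have h5 : 2 / m * X + 2 * (ζ₁ * P) - 2 * (m - 1) * ζ₀ ≤ 2 * (ζ₁ ^ 2 / ζ₀) - ζ₂ - ζ₁ * L := by
    have h := mul_le_mul_of_nonneg_left h4 hζ₀.le
    have e1 : ζ₀ * (2 / m * Q₀ + 2 * c * P - 2 * (m - 1)) =
        2 / m * X + 2 * (ζ₁ * P) - 2 * (m - 1) * ζ₀ := by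
      rw [hX, hc]; field_simp
    have e2 : ζ₀ * (2 * a - b - c * L) = 2 * (ζ₁ ^ 2 / ζ₀) - ζ₂ - ζ₁ * L := by
      rw [ha, hb, hc]; field_simp
    rw [e1, e2] at h; exact h
  -- the individual bounds
  have hsqrtX : Real.sqrt X = Real.sqrt ζ₀ * Real.sqrt Q₀ := by rw [hX, Real.sqrt_mul hζ₀.le]
  have b1 : -(4 * A₁ / R * Real.sqrt X) ≤ 2 * (ζ₁ * P) := by
    have h6 : |ζ₁ * P| ≤ 2 * A₁ / R * Real.sqrt ζ₀ * Real.sqrt Q₀ := by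
      rw [abs_mul]; exact mul_le_mul hζ₁a hP (abs_nonneg _) (by positivity)
    have h7 := (abs_le.1 h6).1
    have e3 : 4 * A₁ / R * Real.sqrt X = 2 * (2 * A₁ / R * Real.sqrt ζ₀ * Real.sqrt Q₀) := by
      rw [hsqrtX]; ring
    rw [e3]; linarith
  have b2 : 2 * (m - 1) * ζ₀ ≤ 2 * m := by nlinarith
  have b3 : 2 * (ζ₁ ^ 2 / ζ₀) ≤ 8 * A₁ ^ 2 / R ^ 2 := by
    have h8 : ζ₁ ^ 2 / ζ₀ ≤ 4 * A₁ ^ 2 / R ^ 2 := by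
      rw [div_le_iff₀ hζ₀]; exact hζ₁sq
    have e4 : (8 : ℝ) * A₁ ^ 2 / R ^ 2 = 2 * (4 * A₁ ^ 2 / R ^ 2) := by ring
    rw [e4]; linarith
  have b4 : -ζ₂ ≤ 2 * A₂ / R ^ 2 := by linarith
  have b5 : -(ζ₁ * L) ≤ 2 * A₁ / R * Λ := by
    have h9 : -ζ₁ ≤ 2 * A₁ / R := by
      have := hζ₁b; rw [abs_of_nonpos hζ₁0] at this; exact this
    have h8 : (-ζ₁) * L ≤ (-ζ₁) * Λ := mul_le_mul_of_nonneg_left hL (by linarith)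
    have h10 : (-ζ₁) * Λ ≤ 2 * A₁ / R * Λ := mul_le_mul_of_nonneg_right h9 hΛ
    have e5 : -(ζ₁ * L) = (-ζ₁) * L := by ring
    rw [e5]; linarith
  -- `(2/m) X ≤ (4A₁/R)√X + B`
  have h11 : 2 / m * X ≤ 4 * A₁ / R * Real.sqrt X +
      (2 * m + 8 * A₁ ^ 2 / R ^ 2 + 2 * A₂ / R ^ 2 + 2 * A₁ / R * Λ) := by linarith
  have h12 : X ≤ 2 * m * A₁ / R * Real.sqrt X +
      (m ^ 2 + 4 * m * A₁ ^ 2 / R ^ 2 + m * A₂ / R ^ 2 + m * A₁ * Λ / R) := by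
    have h := mul_le_mul_of_nonneg_left h11 (show (0 : ℝ) ≤ m / 2 by positivity)
    have e1 : m / 2 * (2 / m * X) = X := by field_simp
    rw [e1] at h
    have e2 : m / 2 * (4 * A₁ / R * Real.sqrt X +
        (2 * m + 8 * A₁ ^ 2 / R ^ 2 + 2 * A₂ / R ^ 2 + 2 * A₁ / R * Λ)) =
        2 * m * A₁ / R * Real.sqrt X +
          (m ^ 2 + 4 * m * A₁ ^ 2 / R ^ 2 + m * A₂ / R ^ 2 + m * A₁ * Λ / R) := by ring
    rw [e2] at h; exact h
  exact le_sq_add_two_mul_of_le_mul_sqrt_add hX0.le h12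

/-- The final constant: with `Λ = m(1 + 4/R)` the bound of `chengYau_arith` is at most
`C(m, A₁, A₂)(1 + 1/R)²`, `C = 4m²A₁² + 2m² + 8mA₁² + 2mA₂ + 10m²A₁`. [folklore] -/
theorem chengYau_const_bound {m A₁ A₂ R : ℝ} (hm : 0 ≤ m) (hA₁ : 0 ≤ A₁) (hA₂ : 0 ≤ A₂) (hR : 0 < R) :
    (2 * m * A₁ / R) ^ 2 +
      2 * (m ^ 2 + 4 * m * A₁ ^ 2 / R ^ 2 + m * A₂ / R ^ 2 + m * A₁ * (m * (1 + 4 / R)) / R) ≤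
      (4 * m ^ 2 * A₁ ^ 2 + 2 * m ^ 2 + 8 * m * A₁ ^ 2 + 2 * m * A₂ + 10 * m ^ 2 * A₁) *
        (1 + 1 / R) ^ 2 := by
  set r : ℝ := 1 / R with hr
  have hr0 : 0 ≤ r := by positivity
  have e1 : (2 * m * A₁ / R) ^ 2 = 4 * m ^ 2 * A₁ ^ 2 * r ^ 2 := by rw [hr]; ring
  have e2 : 4 * m * A₁ ^ 2 / R ^ 2 = 4 * m * A₁ ^ 2 * r ^ 2 := by rw [hr]; ring
  have e3 : m * A₂ / R ^ 2 = m * A₂ * r ^ 2 := by rw [hr]; ring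
  have e4 : m * A₁ * (m * (1 + 4 / R)) / R = m ^ 2 * A₁ * (r + 4 * r ^ 2) := by rw [hr]; ring
  rw [e1, e2, e3, e4]
  have h1 : r ^ 2 ≤ (1 + r) ^ 2 := by nlinarith
  have h2 : (1 : ℝ) ≤ (1 + r) ^ 2 := by nlinarith
  have h3 : r + 4 * r ^ 2 ≤ 5 * (1 + r) ^ 2 := by nlinarith
  have t1 : 4 * m ^ 2 * A₁ ^ 2 * r ^ 2 ≤ 4 * m ^ 2 * A₁ ^ 2 * (1 + r) ^ 2 :=
    mul_le_mul_of_nonneg_left h1 (by positivity)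
  have t2 : 2 * m ^ 2 ≤ 2 * m ^ 2 * (1 + r) ^ 2 := by nlinarith [mul_le_mul_of_nonneg_left h2 (by positivity : (0:ℝ) ≤ 2 * m ^ 2)]
  have t3 : 2 * (4 * m * A₁ ^ 2 * r ^ 2) ≤ 8 * m * A₁ ^ 2 * (1 + r) ^ 2 := by
    nlinarith [mul_le_mul_of_nonneg_left h1 (by positivity : (0:ℝ) ≤ 8 * m * A₁ ^ 2)]
  have t4 : 2 * (m * A₂ * r ^ 2) ≤ 2 * m * A₂ * (1 + r) ^ 2 := by
    nlinarith [mul_le_mul_of_nonneg_left h1 (by positivity : (0:ℝ) ≤ 2 * m * A₂)]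
  have t5 : 2 * (m ^ 2 * A₁ * (r + 4 * r ^ 2)) ≤ 10 * m ^ 2 * A₁ * (1 + r) ^ 2 := by
    nlinarith [mul_le_mul_of_nonneg_left h3 (by positivity : (0:ℝ) ≤ 2 * m ^ 2 * A₁)]
  nlinarith

end Arith

/-! ### §2 The Cheng–Yau gradient estimate -/

section Main

universe u v

variable {E : Type u} [NormedAddCommGroup E] [NormedSpace ℝ E] [FiniteDimensional ℝ E]
  [CompleteSpace E] {M : Type v} [TopologicalSpace M] [ChartedSpace E M] [IsManifold 𝓘(ℝ, E) ∞ M]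
  [T2Space M]
  (g : PseudoRiemannianMetric 𝓘(ℝ, E) ∞ E (TangentSpace 𝓘(ℝ, E) : M → Type _)) [g.HasLeviCivita]
  [CovariantDerivative.ContMDiffCovariantDerivative g.leviCivita 1]
  [CovariantDerivative.ContMDiffCovariantDerivative g.leviCivita ∞]

omit [CompleteSpace E] [T2Space M] [g.HasLeviCivita]
  [CovariantDerivative.ContMDiffCovariantDerivative g.leviCivita 1]
  [CovariantDerivative.ContMDiffCovariantDerivative g.leviCivita ∞] in
/-- `g⁻¹(α, c β) = c g⁻¹(α, β)`. [folklore] -/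
theorem innerDual_smul_right' (x : M) (α β : Module.Dual ℝ (TangentSpace 𝓘(ℝ, E) x)) (c : ℝ) :
    g.innerDual x α (c • β) = c * g.innerDual x α β := by
  simp only [PseudoRiemannianMetric.innerDual, map_smul, smul_eq_mul]

omit [CompleteSpace E] [T2Space M] [g.HasLeviCivita]
  [CovariantDerivative.ContMDiffCovariantDerivative g.leviCivita 1]
  [CovariantDerivative.ContMDiffCovariantDerivative g.leviCivita ∞] in
/-- `g⁻¹(c α, c α) = c² g⁻¹(α, α)`. [folklore] -/
theorem innerDual_smul_smul_eq_sq_mul (x : M) (α : Module.Dual ℝ (TangentSpace 𝓘(ℝ, E) x)) (c : ℝ) :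
    g.innerDual x (c • α) (c • α) = c ^ 2 * g.innerDual x α α := by
  simp only [PseudoRiemannianMetric.innerDual, map_smul, smul_eq_mul, LinearMap.smul_apply]
  ring

set_option maxHeartbeats 800000 in
/-- **The Cheng–Yau local gradient estimate, core form** (Cheng–Yau 1975, Thm. 6; Schoen–Yau,
Ch. I, Thm. 3.1), with the constants of the fixed cutoff profile `χ` explicit: on a connected
Riemannian `m`-manifold (`m ≥ 1`) with complete Levi-Civita connection and `Ric ≥ -(m-1)`, a
`C^∞` function `u > 0`, harmonic where `d(p, ·) < R`, satisfies for `d(p, x) ≤ R/2`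
`|∇ log u|²(x) ≤ (4m²A₁² + 2m² + 8mA₁² + 2mA₂ + 10m²A₁)(1 + 1/R)²`, where `A₁, A₂` bound
`|χ'|, |χ''|`. [cite: ChengYau1975, Thm. 6] -/
theorem chengYau_gradient_estimate_core [ConnectedSpace M] (hg : g.IsRiemannian)
    (hc : IsGeodesicallyComplete g.leviCivita) {m : ℕ} (hmpos : 0 < m)
    (hdim : Module.finrank ℝ E = m)
    (hRic : ∀ (x : M) (w : TangentSpace 𝓘(ℝ, E) x),
      -((m : ℝ) - 1) * g.val x w w ≤ g.leviCivita.ricci x w w)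
    {χ : ℝ → ℝ} {A₁ A₂ : ℝ} (hA₁ : 0 ≤ A₁) (hA₂ : 0 ≤ A₂) (hχs : ContDiff ℝ 2 χ)
    (hχ1 : ∀ t, t ≤ 1 / 2 → χ t = 1) (hχ0 : ∀ t, 1 ≤ t → χ t = 0) (hχnn : ∀ t, 0 ≤ χ t)
    (hχle1 : ∀ t, χ t ≤ 1) (hχanti : Antitone χ)
    (hχd1 : ∀ t, |deriv χ t| ≤ A₁) (hχd1np : ∀ t, deriv χ t ≤ 0) (hχd2 : ∀ t, |deriv (deriv χ) t| ≤ A₂)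
    {u : M → ℝ} (hu : ContMDiff 𝓘(ℝ, E) 𝓘(ℝ, ℝ) ∞ u) (hu0 : ∀ x, 0 < u x)
    (p : M) {R : ℝ} (hR : 0 < R)
    (hharm : ∀ x, (g.edist hg p x).toReal < R → g.laplaceBeltrami u x = 0)
    {x : M} (hx : (g.edist hg p x).toReal ≤ R / 2) :
    g.gradSq (Real.log ∘ u) x ≤
      (4 * (m : ℝ) ^ 2 * A₁ ^ 2 + 2 * (m : ℝ) ^ 2 + 8 * m * A₁ ^ 2 + 2 * m * A₂ +
        10 * (m : ℝ) ^ 2 * A₁) * (1 + 1 / R) ^ 2 := by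
  haveI : Fact ((1 : ℕ∞ω) ≤ (∞ : ℕ∞ω)) := ⟨by exact_mod_cast le_top⟩
  haveI : LocallyCompactSpace M := Manifold.locallyCompact_of_finiteDimensional 𝓘(ℝ, E)
  haveI : RegularSpace M := inferInstance
  have h2le : (2 : ℕ∞ω) ≤ (∞ : ℕ∞ω) := WithTop.coe_le_coe.2 le_top
  have hm : (0 : ℝ) < m := by exact_mod_cast hmpos
  have hm1 : (0 : ℝ) ≤ (m : ℝ) - 1 := by
    have : (1 : ℝ) ≤ m := by exact_mod_cast hmpos
    linarith
  -- the constant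
  set Λ : ℝ := m * (1 + 4 / R) with hΛ
  have hΛ0 : 0 ≤ Λ := by positivity
  set C' : ℝ := (2 * m * A₁ / R) ^ 2 +
      2 * ((m : ℝ) ^ 2 + 4 * m * A₁ ^ 2 / R ^ 2 + m * A₂ / R ^ 2 + m * A₁ * Λ / R) with hC'
  have hC'0 : 0 ≤ C' := by positivity
  have hC'm : 2 * (m : ℝ) ^ 2 ≤ C' := by
    rw [hC']
    have h1 : 0 ≤ (2 * m * A₁ / R) ^ 2 := sq_nonneg _
    have h2 : 0 ≤ 4 * m * A₁ ^ 2 / R ^ 2 + m * A₂ / R ^ 2 + m * A₁ * Λ / R := by positivity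
    linarith
  have hC'C := chengYau_const_bound hm.le hA₁ hA₂ hR
  rw [← hΛ] at hC'C
  refine le_trans ?_ hC'C
  -- `φ = log u`, `Q = |∇φ|²`
  set φ : M → ℝ := Real.log ∘ u with hφ_def
  have hφ : ContMDiff 𝓘(ℝ, E) 𝓘(ℝ, ℝ) ∞ φ := fun y ↦
    ((Real.contDiffAt_log.2 (hu0 y).ne').contMDiffAt).comp y (hu y)
  set Q : M → ℝ := g.gradSq φ with hQ_def
  have hQs : ContMDiff 𝓘(ℝ, E) 𝓘(ℝ, ℝ) ∞ Q := contMDiff_gradSq g hφ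
  have hQ0 : ∀ y, 0 ≤ Q y := fun y ↦ g.innerDual_self_nonneg hg y _
  -- the Ricci hypothesis in the two spellings
  have hRicK : ∀ (y : M) (w : TangentSpace 𝓘(ℝ, E) y), (-((m : ℝ) - 1)) * g.val y w w ≤ g.ricci y w w :=
    fun y w ↦ hRic y w
  have hRicF : ∀ (y : M) (w : TangentSpace 𝓘(ℝ, E) y),
      -((Module.finrank ℝ E : ℝ) - 1) * g.val y w w ≤ g.leviCivita.ricci y w w := by
    rw [hdim]; exact hRic
  -- the distance from `p`
  set ρ : M → ℝ := fun y ↦ (g.edist hg p y).toReal with hρ_def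
  have hρcont : Continuous ρ :=
    ENNReal.continuousOn_toReal.comp_continuous
      ((PseudoRiemannianMetric.continuous_edist hg).comp (Continuous.prodMk_right p))
      fun y ↦ edist_ne_top hg p y
  have hρ0 : ∀ y, 0 ≤ ρ y := fun y ↦ ENNReal.toReal_nonneg
  have hx' : ρ x ≤ R / 2 := hx
  -- `Δφ = -Q` on the ball
  have hΔφ : ∀ y, ρ y < R → g.dalembertian φ y = -Q y := by
    intro y hy
    have huy : ContMDiffAt 𝓘(ℝ, E) 𝓘(ℝ, ℝ) 2 u y := (hu y).of_le h2le
    have hlog : ContDiffAt ℝ 2 Real.log (u y) := Real.contDiffAt_log.2 (hu0 y).ne'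
    have h1 := g.dalembertian_real_comp huy hlog
    have hd1 : deriv Real.log (u y) = (u y)⁻¹ := Real.deriv_log (u y)
    have hd2 : deriv (deriv Real.log) (u y) = -((u y) ^ 2)⁻¹ := by
      rw [show deriv Real.log = fun x ↦ x⁻¹ from funext Real.deriv_log, deriv_inv]
    have hΔu : g.dalembertian u y = 0 := by rw [← laplaceBeltrami_eq_dalembertian]; exact hharm y hy
    rw [hd1, hd2, hΔu, mul_zero, add_zero] at h1
    have hud : MDifferentiableAt 𝓘(ℝ, E) 𝓘(ℝ, ℝ) u y := (hu y).mdifferentiableAt (by simp)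
    have hQy : Q y = (u y)⁻¹ ^ 2 * g.gradSq u y := by
      show g.gradSq (Real.log ∘ u) y = _
      rw [gradSq_comp_real_eq_deriv_sq_mul g (Real.differentiableAt_log (hu0 y).ne') hud, hd1]
    rw [h1, hQy, PseudoRiemannianMetric.gradSq]
    have hu2 : (u y) ^ 2 ≠ 0 := pow_ne_zero 2 (hu0 y).ne'
    field_simp
  -- compact distance balls
  have hcpt : ∀ r : ℝ, IsCompact {z | ρ z ≤ r} := by
    intro r
    by_cases hr : r < 0
    · have : {z | ρ z ≤ r} = ∅ := Set.eq_empty_of_forall_notMem fun z hz ↦ by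
        have := hρ0 z; simp only [mem_setOf_eq] at hz; linarith
      rw [this]; exact isCompact_empty
    rw [not_lt] at hr
    have h := isCompact_setOf_edist_le g le_rfl hg hc p r.toNNReal
    convert h using 1
    ext z
    simp only [mem_setOf_eq]
    rw [show ρ z = (g.edist hg p z).toReal from rfl,
      ← ENNReal.ofReal_toReal (edist_ne_top hg p z), ENNReal.toReal_ofReal ENNReal.toReal_nonneg,
      show ((r.toNNReal : ℝ≥0) : ℝ≥0∞) = ENNReal.ofReal r from rfl,
      ENNReal.ofReal_le_ofReal_iff hr]
  -- the cutoff `η = χ(ρ/R)²` and `G = η Q`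
  set η : M → ℝ := fun y ↦ χ (ρ y / R) ^ 2 with hη_def
  have hηcont : Continuous η := (hχs.continuous.comp (hρcont.div_const R)).pow 2
  have hη0 : ∀ y, 0 ≤ η y := fun y ↦ sq_nonneg _
  have hη1 : ∀ y, ρ y ≤ R / 2 → η y = 1 := fun y hy ↦ by
    show χ (ρ y / R) ^ 2 = 1
    rw [hχ1 _ (by rw [div_le_iff₀ hR]; linarith), one_pow]
  set G : M → ℝ := fun y ↦ η y * Q y with hG_def
  have hGcont : Continuous G := hηcont.mul hQs.continuous
  have hG0 : ∀ y, 0 ≤ G y := fun y ↦ mul_nonneg (hη0 y) (hQ0 y)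
  -- the maximum point
  obtain ⟨x₀, hx₀K, hx₀max⟩ := (hcpt R).exists_isMaxOn ⟨p, show ρ p ≤ R by
    rw [show ρ p = (g.edist hg p p).toReal from rfl, PseudoRiemannianMetric.edist_self,
      ENNReal.toReal_zero]; exact hR.le⟩ hGcont.continuousOn
  have hx₀R : ρ x₀ ≤ R := hx₀K
  have hGle : ∀ y, ρ y ≤ R → G y ≤ G x₀ := fun y hy ↦ hx₀max hy
  -- reduction to `G x₀ ≤ C'`
  have hxG : Q x = G x := by
    show Q x = η x * Q x
    rw [hη1 x hx', one_mul]
  show Q x ≤ _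
  rw [hxG]
  refine (hGle x (by linarith)).trans ?_
  -- `G x₀ ≤ C'`
  rcases (hG0 x₀).eq_or_lt with hG00 | hGpos
  · rw [← hG00]; exact hC'0
  have hηpos : 0 < η x₀ := by
    rcases (hη0 x₀).eq_or_lt with h | h
    · exfalso; have : G x₀ = 0 := by show η x₀ * Q x₀ = 0; rw [← h, zero_mul]
      linarith
    · exact h
  have hQpos : 0 < Q x₀ := by
    rcases (hQ0 x₀).eq_or_lt with h | h
    · exfalso; have : G x₀ = 0 := by show η x₀ * Q x₀ = 0; rw [← h, mul_zero]
      linarith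
    · exact h
  have hρ₀R : ρ x₀ < R := by
    by_contra hle
    rw [not_lt] at hle
    have : χ (ρ x₀ / R) = 0 := hχ0 _ (by rw [le_div_iff₀ hR]; linarith)
    have : η x₀ = 0 := by show χ (ρ x₀ / R) ^ 2 = 0; rw [this]; ring
    linarith
  -- positivity of `g_{x₀}`
  have hpos : ∀ v : TangentSpace 𝓘(ℝ, E) x₀, v ≠ 0 → 0 < g.val x₀ v v := fun v hv ↦ hg x₀ v hv
  -- Bochner at `x₀`
  have hB := dalembertian_gradSq_ge_of_ricci_ge g hg hRicK hφ x₀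
  rw [hdim] at hB
  -- `dΔφ = -dQ` at `x₀` (the ball is a neighbourhood)
  have hballmem : {y | ρ y < R} ∈ 𝓝 x₀ := (isOpen_lt hρcont continuous_const).mem_nhds hρ₀R
  have hΔφev : g.dalembertian φ =ᶠ[𝓝 x₀] fun y ↦ -Q y := by
    filter_upwards [hballmem] with y hy using hΔφ y hy
  have hQd : MDifferentiableAt 𝓘(ℝ, E) 𝓘(ℝ, ℝ) Q x₀ := (hQs x₀).mdifferentiableAt (by simp)
  have hdΔφ : ∀ v, mvfderiv 𝓘(ℝ, E) (g.dalembertian φ) x₀ v = -mvfderiv 𝓘(ℝ, E) Q x₀ v := by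
    intro v
    rw [mvfderiv_congr_of_eventuallyEq hΔφev,
      show (fun y ↦ -Q y) = Neg.neg ∘ Q from rfl,
      mvfderiv_real_comp (hasDerivAt_neg (Q x₀)).differentiableAt hQd v, deriv_neg, neg_one_mul]
  rcases lt_or_ge (ρ x₀) (R / 2) with hcase | hcase
  · /- Case A: `ρ(x₀) < R/2`, where `η ≡ 1` near `x₀`: `Q` itself has a local maximum. -/
    have hU : {y | ρ y < R / 2} ∈ 𝓝 x₀ := (isOpen_lt hρcont continuous_const).mem_nhds hcase
    have hηx₀ : η x₀ = 1 := hη1 x₀ hcase.le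
    have hlocQ : IsLocalMax Q x₀ := by
      filter_upwards [hU] with y hy
      have hy' : ρ y < R / 2 := hy
      have h1 := hGle y (by linarith)
      have h2 : G y = Q y := by show η y * Q y = Q y; rw [hη1 y hy'.le, one_mul]
      have h3 : G x₀ = Q x₀ := by show η x₀ * Q x₀ = Q x₀; rw [hηx₀, one_mul]
      rw [← h2, ← h3]; exact h1
    have hdQ : mvfderiv 𝓘(ℝ, E) Q x₀ = 0 := mvfderiv_eq_zero_of_isLocalMax (I := 𝓘(ℝ, E)) hlocQ
    have hΔQ : g.dalembertian Q x₀ ≤ 0 :=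
      g.dalembertian_nonpos_of_isLocalMax ((hQs x₀).of_le h2le) hlocQ hpos
    have hdΔφ0 : mvfderiv 𝓘(ℝ, E) (g.dalembertian φ) x₀ = 0 := by
      ext v; rw [hdΔφ v, hdQ]; simp
    rw [hdΔφ0, hΔφ x₀ hρ₀R] at hB
    have h0 : g.innerDual x₀ (mvfderiv 𝓘(ℝ, E) φ x₀ : TangentSpace 𝓘(ℝ, E) x₀ →ₗ[ℝ] ℝ)
        ((0 : TangentSpace 𝓘(ℝ, E) x₀ →L[ℝ] ℝ) : TangentSpace 𝓘(ℝ, E) x₀ →ₗ[ℝ] ℝ) = 0 := by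
      rw [innerDual_eq_val_sharp_sharp, ContinuousLinearMap.toLinearMap_zero, map_zero, map_zero]
    rw [h0, mul_zero, add_zero] at hB
    -- `(2/m) Q₀² - 2(m-1) Q₀ ≤ ΔQ ≤ 0`
    have hB' : 2 / (m : ℝ) * Q x₀ ^ 2 - 2 * ((m : ℝ) - 1) * Q x₀ ≤ 0 := by
      have e : 2 / (m : ℝ) * (-Q x₀) ^ 2 + 2 * -((m : ℝ) - 1) * g.gradSq φ x₀ =
          2 / (m : ℝ) * Q x₀ ^ 2 - 2 * ((m : ℝ) - 1) * Q x₀ := by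
        show 2 / (m : ℝ) * (-Q x₀) ^ 2 + 2 * -((m : ℝ) - 1) * Q x₀ = _; ring
      linarith
    have hQb : Q x₀ ≤ m * ((m : ℝ) - 1) := by
      have h1 : 2 / (m : ℝ) * Q x₀ ≤ 2 * ((m : ℝ) - 1) := by
        by_contra hcon
        rw [not_le] at hcon
        have h3 := mul_lt_mul_of_pos_right hcon hQpos
        have e : 2 / (m : ℝ) * Q x₀ * Q x₀ = 2 / (m : ℝ) * Q x₀ ^ 2 := by ring
        linarith
      rw [div_mul_eq_mul_div, div_le_iff₀ hm] at h1
      have e : 2 * ((m : ℝ) - 1) * m = 2 * (m * ((m : ℝ) - 1)) := by ring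
      linarith
    have hmm : (m : ℝ) * ((m : ℝ) - 1) ≤ 2 * (m : ℝ) ^ 2 := by
      have e : (m : ℝ) * ((m : ℝ) - 1) = (m : ℝ) ^ 2 - m := by ring
      rw [e]; linarith [sq_nonneg (m : ℝ)]
    calc G x₀ = Q x₀ := by show η x₀ * Q x₀ = Q x₀; rw [hηx₀, one_mul]
      _ ≤ m * ((m : ℝ) - 1) := hQb
      _ ≤ 2 * (m : ℝ) ^ 2 := hmm
      _ ≤ C' := hC'm
  · /- Case B: `R/2 ≤ ρ(x₀) < R`; Calabi's trick. -/
    have hx₀p : x₀ ≠ p := by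
      intro h
      have : ρ x₀ = 0 := by
        rw [h, show ρ p = (g.edist hg p p).toReal from rfl, PseudoRiemannianMetric.edist_self,
          ENNReal.toReal_zero]
      linarith
    set δ : ℝ := R / 4 with hδ
    have hδ0 : 0 < δ := by positivity
    have hδρ : δ < (g.edist hg p x₀).toReal := by show δ < ρ x₀; linarith
    obtain ⟨q, -, hqx, htri, hsmooth, hΔq⟩ :=
      exists_smooth_upper_barrier_edist g hg hc hRicF hx₀p hδ0 hδρ
    set t₀ : ℝ := (g.edist hg q x₀).toReal with ht₀_def
    have ht₀ : t₀ = ρ x₀ - δ := by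
      rw [ht₀_def, hqx, ENNReal.toReal_ofReal (by show 0 ≤ ρ x₀ - δ; linarith)]
    have ht₀pos : 0 < t₀ := by rw [ht₀]; linarith
    have hx₀q : x₀ ≠ q := by
      intro h
      have : t₀ = 0 := by
        rw [ht₀_def, h, PseudoRiemannianMetric.edist_self, ENNReal.toReal_zero]
      linarith
    -- the Laplacian comparison bound `L₀ ≤ Λ`
    set L₀ : ℝ := g.dalembertian (fun z ↦ (g.edist hg q z).toReal) x₀ with hL₀
    have hL : L₀ ≤ Λ := by
      have h1 : L₀ ≤ ((Module.finrank ℝ E : ℝ) - 1) *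
          (Real.cosh ((g.edist hg p x₀).toReal - δ) / Real.sinh ((g.edist hg p x₀).toReal - δ)) := by
        rw [hL₀, ← laplaceBeltrami_eq_dalembertian]; exact hΔq
      rw [hdim] at h1
      have h2 : Real.cosh (ρ x₀ - δ) / Real.sinh (ρ x₀ - δ) ≤ 1 + 1 / (ρ x₀ - δ) :=
        cosh_div_sinh_le (by linarith)
      have h3 : 1 / (ρ x₀ - δ) ≤ 4 / R := by
        rw [div_le_div_iff₀ (by linarith) hR]; linarith
      have h4 : ((m : ℝ) - 1) * (Real.cosh (ρ x₀ - δ) / Real.sinh (ρ x₀ - δ)) ≤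
          ((m : ℝ) - 1) * (1 + 4 / R) := mul_le_mul_of_nonneg_left (by linarith) hm1
      have h5 : ((m : ℝ) - 1) * (1 + 4 / R) ≤ Λ := by
        rw [hΛ]; exact mul_le_mul_of_nonneg_right (by linarith) (by positivity)
      exact h1.trans (h4.trans h5)
    -- the profile `ζ(t) = χ((δ + t)/R)²` and its derivatives
    set sc : ℝ → ℝ := fun t ↦ (δ + t) / R with hsc
    set ζ : ℝ → ℝ := fun t ↦ χ (sc t) ^ 2 with hζ
    set ζ₁f : ℝ → ℝ := fun t ↦ 2 * χ (sc t) * deriv χ (sc t) / R with hζ₁f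
    have hχdiff : Differentiable ℝ χ := hχs.differentiable (by norm_num)
    have hχ'diff : Differentiable ℝ (deriv χ) := by
      have h : ContDiff ℝ 1 (deriv χ) := by
        have h3 : ContDiff ℝ (1 + 1) χ := hχs.of_le (by norm_cast)
        simpa using h3.iterate_deriv' 1 1
      exact h.differentiable one_ne_zero
    have hscd : ∀ t, HasDerivAt sc (1 / R) t := fun t ↦ by
      have h := ((hasDerivAt_id t).const_add δ).div_const R
      simpa [hsc] using h
    have hζd : ∀ t, HasDerivAt ζ (ζ₁f t) t := by
      intro t
      have h1 : HasDerivAt (fun t ↦ χ (sc t)) (deriv χ (sc t) * (1 / R)) t :=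
        (hχdiff (sc t)).hasDerivAt.comp t (hscd t)
      have h2 := h1.pow 2
      refine h2.congr_deriv ?_
      simp only [hζ₁f]; ring
    have hζ' : deriv ζ = ζ₁f := funext fun t ↦ (hζd t).deriv
    set ζ₂v : ℝ := 2 * (deriv χ (sc t₀)) ^ 2 / R ^ 2 +
      2 * χ (sc t₀) * deriv (deriv χ) (sc t₀) / R ^ 2 with hζ₂v
    have hζ₁fd : HasDerivAt ζ₁f ζ₂v t₀ := by
      have h1 : HasDerivAt (fun t ↦ χ (sc t)) (deriv χ (sc t₀) * (1 / R)) t₀ :=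
        (hχdiff (sc t₀)).hasDerivAt.comp t₀ (hscd t₀)
      have h2 : HasDerivAt (fun t ↦ deriv χ (sc t)) (deriv (deriv χ) (sc t₀) * (1 / R)) t₀ :=
        (hχ'diff (sc t₀)).hasDerivAt.comp t₀ (hscd t₀)
      have h3 := ((h1.fun_mul h2).const_mul 2).div_const R
      have h4 : ζ₁f = fun t ↦ 2 * (χ (sc t) * deriv χ (sc t)) / R := by
        funext t; simp only [hζ₁f]; ring
      rw [h4]
      refine h3.congr_deriv ?_
      rw [hζ₂v]; field_simp
    have hζs2 : ContDiff ℝ 2 ζ := by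
      rw [hζ]; exact (hχs.comp ((contDiff_const.add contDiff_id).div_const R)).pow 2
    -- values at `t₀`
    have hsct₀ : sc t₀ = ρ x₀ / R := by simp only [hsc]; rw [ht₀]; ring_nf
    have hζ₀η : (ζ t₀) = η x₀ := by
      show χ (sc t₀) ^ 2 = χ (ρ x₀ / R) ^ 2; rw [hsct₀]
    have hζ₀pos : 0 < (ζ t₀) := by rw [hζ₀η]; exact hηpos
    have hζ₀1 : (ζ t₀) ≤ 1 := by
      show χ (sc t₀) ^ 2 ≤ 1
      exact pow_le_one₀ (hχnn _) (hχle1 _)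
    have hsqrtζ₀ : Real.sqrt (ζ t₀) = χ (sc t₀) := by
      show Real.sqrt (χ (sc t₀) ^ 2) = _; exact Real.sqrt_sq (hχnn _)
    have hζ₁0 : (ζ₁f t₀) ≤ 0 := by
      show 2 * χ (sc t₀) * deriv χ (sc t₀) / R ≤ 0
      exact div_nonpos_of_nonpos_of_nonneg
        (mul_nonpos_of_nonneg_of_nonpos (by linarith [hχnn (sc t₀)]) (hχd1np _)) hR.le
    have habsζ₁ : |(ζ₁f t₀)| = 2 * χ (sc t₀) * |deriv χ (sc t₀)| / R := by
      show |2 * χ (sc t₀) * deriv χ (sc t₀) / R| = _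
      rw [abs_div, abs_mul, abs_mul, abs_of_pos hR, abs_of_nonneg (hχnn _), abs_two]
    have hζ₁a : |(ζ₁f t₀)| ≤ 2 * A₁ / R * Real.sqrt (ζ t₀) := by
      rw [habsζ₁, hsqrtζ₀]
      have h1 := hχd1 (sc t₀)
      have h2 := hχnn (sc t₀)
      rw [div_le_iff₀ hR]
      have : 2 * A₁ / R * χ (sc t₀) * R = 2 * A₁ * χ (sc t₀) := by field_simp
      rw [this]
      have h3 := mul_le_mul_of_nonneg_left h1 h2
      linarith
    have hζ₁b : |(ζ₁f t₀)| ≤ 2 * A₁ / R := by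
      refine hζ₁a.trans ?_
      rw [hsqrtζ₀]
      have h0 : 0 ≤ 2 * A₁ / R := by positivity
      calc 2 * A₁ / R * χ (sc t₀) ≤ 2 * A₁ / R * 1 := mul_le_mul_of_nonneg_left (hχle1 _) h0
        _ = 2 * A₁ / R := mul_one _
    have hζ₁sq : (ζ₁f t₀) ^ 2 ≤ 4 * A₁ ^ 2 / R ^ 2 * (ζ t₀) := by
      show (2 * χ (sc t₀) * deriv χ (sc t₀) / R) ^ 2 ≤ 4 * A₁ ^ 2 / R ^ 2 * χ (sc t₀) ^ 2
      have h1 : deriv χ (sc t₀) ^ 2 ≤ A₁ ^ 2 := by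
        have := hχd1 (sc t₀); exact sq_le_sq' (abs_le.1 this).1 (abs_le.1 this).2
      rw [div_pow, div_mul_eq_mul_div, div_le_div_iff_of_pos_right (by positivity)]
      have h2 := mul_le_mul_of_nonneg_left h1 (by positivity : (0 : ℝ) ≤ 4 * χ (sc t₀) ^ 2)
      have e : (2 * χ (sc t₀) * deriv χ (sc t₀)) ^ 2 = 4 * χ (sc t₀) ^ 2 * deriv χ (sc t₀) ^ 2 := by
        ring
      rw [e]; linarith
    have hζ₂ : -(2 * A₂ / R ^ 2) ≤ ζ₂v := by
      rw [hζ₂v]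
      have h1 : 0 ≤ 2 * deriv χ (sc t₀) ^ 2 / R ^ 2 := by positivity
      have h2 : -A₂ ≤ χ (sc t₀) * deriv (deriv χ) (sc t₀) := by
        have h3 := abs_le.1 (hχd2 (sc t₀))
        have h4 := hχnn (sc t₀)
        have h5 := hχle1 (sc t₀)
        have h6 := mul_le_mul_of_nonneg_left h3.1 h4
        have h7 := mul_nonneg (sub_nonneg.2 h5) hA₂
        have e : (1 - χ (sc t₀)) * A₂ = A₂ - χ (sc t₀) * A₂ := by ring
        have e2 : χ (sc t₀) * -A₂ = -(χ (sc t₀) * A₂) := by ring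
        linarith
      have h6 : -(2 * A₂ / R ^ 2) ≤ 2 * χ (sc t₀) * deriv (deriv χ) (sc t₀) / R ^ 2 := by
        have h7 := mul_le_mul_of_nonneg_left h2 (by positivity : (0 : ℝ) ≤ 2 / R ^ 2)
        have e1 : 2 / R ^ 2 * -A₂ = -(2 * A₂ / R ^ 2) := by ring
        have e2 : 2 / R ^ 2 * (χ (sc t₀) * deriv (deriv χ) (sc t₀)) =
            2 * χ (sc t₀) * deriv (deriv χ) (sc t₀) / R ^ 2 := by ring
        linarith only [h7, e1, e2]
      linarith only [h1, h6]
    -- the modified cutoff `η̃ = ζ ∘ d_q` and `F = log Q + log η̃`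
    set dq : M → ℝ := fun z ↦ (g.edist hg q z).toReal with hdq
    set ηt : M → ℝ := fun y ↦ ζ (dq y) with hηt
    have hηtle : ∀ y, ηt y ≤ η y := by
      intro y
      have h1 : ρ y ≤ δ + dq y := by
        have h2 := ENNReal.toReal_mono (ENNReal.add_ne_top.2 ⟨ENNReal.ofReal_ne_top, edist_ne_top hg q y⟩)
          (htri y)
        rwa [ENNReal.toReal_add ENNReal.ofReal_ne_top (edist_ne_top hg q y), ENNReal.toReal_ofReal hδ0.le] at h2
      have h3 : χ (sc (dq y)) ≤ χ (ρ y / R) :=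
        hχanti (by show ρ y / R ≤ (δ + dq y) / R; exact div_le_div_of_nonneg_right h1 hR.le)
      show χ (sc (dq y)) ^ 2 ≤ χ (ρ y / R) ^ 2
      exact pow_le_pow_left₀ (hχnn _) h3 2
    have hηtx₀ : ηt x₀ = η x₀ := hζ₀η
    have hdqcont : Continuous dq :=
      ENNReal.continuousOn_toReal.comp_continuous
        ((PseudoRiemannianMetric.continuous_edist hg).comp (Continuous.prodMk_right q))
        fun y ↦ edist_ne_top hg q y
    have hηtcont : Continuous ηt := hζs2.continuous.comp hdqcont
    -- positivity near `x₀`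
    have hev : ∀ᶠ y in 𝓝 x₀, 0 < Q y ∧ 0 < ηt y ∧ ρ y < R := by
      have h1 : ∀ᶠ y in 𝓝 x₀, 0 < Q y := hQs.continuous.continuousAt.eventually (lt_mem_nhds hQpos)
      have h2 : ∀ᶠ y in 𝓝 x₀, 0 < ηt y :=
        hηtcont.continuousAt.eventually (lt_mem_nhds (by rw [hηtx₀]; exact hηpos))
      filter_upwards [h1, h2, hballmem] with y a b c using ⟨a, b, c⟩
    have hηt0 : 0 < ηt x₀ := by rw [hηtx₀]; exact hηpos
    set F : M → ℝ := fun y ↦ Real.log (Q y) + 1 * Real.log (ηt y) with hF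
    have hFmax : IsLocalMax F x₀ := by
      filter_upwards [hev] with y hy
      obtain ⟨hQy, hηy, hρy⟩ := hy
      have h1 : Q y * ηt y ≤ Q x₀ * ηt x₀ := by
        have h2 := hGle y hρy.le
        have h3 : G y = η y * Q y := rfl
        have h4 : G x₀ = η x₀ * Q x₀ := rfl
        have h5 := mul_le_mul_of_nonneg_left (hηtle y) (hQ0 y)
        rw [hηtx₀]
        have e1 : η y * Q y = Q y * η y := mul_comm _ _
        have e2 : η x₀ * Q x₀ = Q x₀ * η x₀ := mul_comm _ _
        linarith only [h2, h3, h4, h5, e1, e2]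
      have h6 : Real.log (Q y) + 1 * Real.log (ηt y) ≤ Real.log (Q x₀) + 1 * Real.log (ηt x₀) := by
        rw [one_mul, one_mul, ← Real.log_mul (x := Q y) (y := ηt y) hQy.ne' hηy.ne',
          ← Real.log_mul (x := Q x₀) (y := ηt x₀) hQpos.ne' hηt0.ne']
        exact Real.log_le_log (mul_pos hQy hηy) h1
      exact h6
    -- smoothness at `x₀`
    have hlogQ : ContMDiffAt 𝓘(ℝ, E) 𝓘(ℝ, ℝ) 2 (fun y ↦ Real.log (Q y)) x₀ :=
      ((Real.contDiffAt_log.2 hQpos.ne').contMDiffAt).comp x₀ ((hQs x₀).of_le h2le)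
    have hθ : ContDiffAt ℝ 2 (Real.log ∘ ζ) t₀ :=
      (Real.contDiffAt_log.2 hζ₀pos.ne').comp t₀ hζs2.contDiffAt
    have hdq2 : ContMDiffAt 𝓘(ℝ, E) 𝓘(ℝ, ℝ) 2 dq x₀ := hsmooth.of_le h2le
    have hdqd : MDifferentiableAt 𝓘(ℝ, E) 𝓘(ℝ, ℝ) dq x₀ := hsmooth.mdifferentiableAt (by simp)
    have hlogη : ContMDiffAt 𝓘(ℝ, E) 𝓘(ℝ, ℝ) 2 (fun y ↦ Real.log (ηt y)) x₀ :=
      hθ.contMDiffAt.comp x₀ hdq2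
    have hF2 : ContMDiffAt 𝓘(ℝ, E) 𝓘(ℝ, ℝ) 2 F x₀ := hlogQ.add (contMDiffAt_const.mul hlogη)
    -- derivatives of `log ∘ ζ` at `t₀`
    have hθd : HasDerivAt (Real.log ∘ ζ) ((ζ t₀)⁻¹ * (ζ₁f t₀)) t₀ := by
      exact (Real.hasDerivAt_log hζ₀pos.ne').comp t₀ (hζd t₀)
    have hθ' : deriv (Real.log ∘ ζ) t₀ = (ζ₁f t₀) / (ζ t₀) := by rw [hθd.deriv]; ring
    have hθ'' : deriv (deriv (Real.log ∘ ζ)) t₀ = ζ₂v / (ζ t₀) - (ζ₁f t₀) ^ 2 / (ζ t₀) ^ 2 := by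
      have hζcont : ContinuousAt ζ t₀ := hζs2.continuous.continuousAt
      have hevζ : ∀ᶠ t in 𝓝 t₀, 0 < ζ t := hζcont.eventually (lt_mem_nhds hζ₀pos)
      have heq : deriv (Real.log ∘ ζ) =ᶠ[𝓝 t₀] fun t ↦ (ζ t)⁻¹ * ζ₁f t := by
        filter_upwards [hevζ] with t ht
        exact ((Real.hasDerivAt_log ht.ne').comp t (hζd t)).deriv
      rw [heq.deriv_eq]
      have h1 : HasDerivAt (fun t ↦ (ζ t)⁻¹ * ζ₁f t)
          (-(ζ₁f t₀) / ζ t₀ ^ 2 * ζ₁f t₀ + (ζ t₀)⁻¹ * ζ₂v) t₀ :=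
        ((hζd t₀).inv hζ₀pos.ne').mul hζ₁fd
      rw [h1.deriv]
      show -(ζ₁f t₀) / (ζ t₀) ^ 2 * (ζ₁f t₀) + (ζ t₀)⁻¹ * ζ₂v = ζ₂v / (ζ t₀) - (ζ₁f t₀) ^ 2 / (ζ t₀) ^ 2
      field_simp; ring
    -- first order condition: `dQ = -(Q₀ (ζ₁f t₀)/(ζ t₀)) d(d_q)` at `x₀`
    have hlogQd : MDifferentiableAt 𝓘(ℝ, E) 𝓘(ℝ, ℝ) (fun y ↦ Real.log (Q y)) x₀ := by
      exact hlogQ.mdifferentiableAt (by norm_num)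
    have hlogηd : MDifferentiableAt 𝓘(ℝ, E) 𝓘(ℝ, ℝ) (fun y ↦ Real.log (ηt y)) x₀ := by
      exact hlogη.mdifferentiableAt (by norm_num)
    have hdF : mvfderiv 𝓘(ℝ, E) F x₀ = 0 := mvfderiv_eq_zero_of_isLocalMax (I := 𝓘(ℝ, E)) hFmax
    have hdQ : mvfderiv 𝓘(ℝ, E) Q x₀ = (-(Q x₀ * (ζ₁f t₀) / (ζ t₀))) • mvfderiv 𝓘(ℝ, E) dq x₀ := by
      ext v
      have h1 : mvfderiv 𝓘(ℝ, E) F x₀ v = 0 := by rw [hdF]; simp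
      rw [show F = fun y ↦ (fun y ↦ Real.log (Q y)) y + 1 * (fun y ↦ Real.log (ηt y)) y from rfl,
        mvfderiv_add_const_mul_apply hlogQd hlogηd 1 v, one_mul,
        show (fun y ↦ Real.log (Q y)) = Real.log ∘ Q from rfl,
        show (fun y ↦ Real.log (ηt y)) = (Real.log ∘ ζ) ∘ dq from rfl,
        mvfderiv_real_comp (Real.differentiableAt_log hQpos.ne') hQd v,
        mvfderiv_real_comp (hθ.differentiableAt (by norm_num : (2 : ℕ∞ω) ≠ 0)) hdqd v, Real.deriv_log, hθ'] at h1
      simp only [FunLike.coe_smul, Pi.smul_apply, smul_eq_mul]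
      have hQne : Q x₀ ≠ 0 := hQpos.ne'
      field_simp
      field_simp at h1
      linarith only [h1]
    -- second order condition
    have hΔF : g.dalembertian F x₀ ≤ 0 := g.dalembertian_nonpos_of_isLocalMax hF2 hFmax hpos
    have heik : g.innerDual x₀ (mvfderiv 𝓘(ℝ, E) dq x₀ : TangentSpace 𝓘(ℝ, E) x₀ →ₗ[ℝ] ℝ)
        (mvfderiv 𝓘(ℝ, E) dq x₀ : TangentSpace 𝓘(ℝ, E) x₀ →ₗ[ℝ] ℝ) = 1 := by
      have h := gradSq_edist_eq_one_of_mdifferentiableAt g hg hc hx₀q hdqd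
      rwa [PseudoRiemannianMetric.gradSq] at h
    set D : ℝ := g.dalembertian Q x₀ with hD
    have hSQ : g.innerDual x₀ (mvfderiv 𝓘(ℝ, E) Q x₀ : TangentSpace 𝓘(ℝ, E) x₀ →ₗ[ℝ] ℝ)
        (mvfderiv 𝓘(ℝ, E) Q x₀ : TangentSpace 𝓘(ℝ, E) x₀ →ₗ[ℝ] ℝ) = (Q x₀ * (ζ₁f t₀) / (ζ t₀)) ^ 2 := by
      rw [hdQ, ContinuousLinearMap.toLinearMap_smul, innerDual_smul_smul_eq_sq_mul, heik, mul_one, neg_sq]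
    have hΔlogQ : g.dalembertian (fun y ↦ Real.log (Q y)) x₀ = -((ζ₁f t₀) ^ 2 / (ζ t₀) ^ 2) + D / Q x₀ := by
      rw [show (fun y ↦ Real.log (Q y)) = Real.log ∘ Q from rfl,
        g.dalembertian_real_comp ((hQs x₀).of_le h2le) (Real.contDiffAt_log.2 hQpos.ne'), hSQ,
        Real.deriv_log, show deriv Real.log = fun x ↦ x⁻¹ from funext Real.deriv_log, deriv_inv]
      have hQne : Q x₀ ≠ 0 := hQpos.ne'
      field_simp
      ring
    have hΔlogη : g.dalembertian (fun y ↦ Real.log (ηt y)) x₀ =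
        (ζ₂v / (ζ t₀) - (ζ₁f t₀) ^ 2 / (ζ t₀) ^ 2) + (ζ₁f t₀) / (ζ t₀) * L₀ := by
      rw [show (fun y ↦ Real.log (ηt y)) = (Real.log ∘ ζ) ∘ dq from rfl,
        g.dalembertian_real_comp hdq2 hθ, heik, mul_one, hθ'', hθ']
    have h1 : D / Q x₀ - (ζ₁f t₀) ^ 2 / (ζ t₀) ^ 2 + (ζ₂v / (ζ t₀) - (ζ₁f t₀) ^ 2 / (ζ t₀) ^ 2) + (ζ₁f t₀) / (ζ t₀) * L₀ ≤ 0 := by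
      have e : g.dalembertian F x₀ = g.dalembertian (fun y ↦ Real.log (Q y)) x₀ +
          1 * g.dalembertian (fun y ↦ Real.log (ηt y)) x₀ :=
        g.dalembertian_add_const_mul_of_contMDiffAt hlogQ hlogη 1
      rw [e, hΔlogQ, hΔlogη] at hΔF
      linarith only [hΔF]
    -- Bochner: `h2`
    set P : ℝ := g.innerDual x₀ (mvfderiv 𝓘(ℝ, E) φ x₀ : TangentSpace 𝓘(ℝ, E) x₀ →ₗ[ℝ] ℝ)
      (mvfderiv 𝓘(ℝ, E) dq x₀ : TangentSpace 𝓘(ℝ, E) x₀ →ₗ[ℝ] ℝ) with hP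
    have hPb : |P| ≤ Real.sqrt (Q x₀) := by
      have h := abs_innerDual_le_sqrt_mul_sqrt g hg x₀
        (mvfderiv 𝓘(ℝ, E) φ x₀ : TangentSpace 𝓘(ℝ, E) x₀ →ₗ[ℝ] ℝ)
        (mvfderiv 𝓘(ℝ, E) dq x₀ : TangentSpace 𝓘(ℝ, E) x₀ →ₗ[ℝ] ℝ)
      rw [heik, Real.sqrt_one, mul_one] at h
      exact h
    have hdΔφ' : mvfderiv 𝓘(ℝ, E) (g.dalembertian φ) x₀ = (Q x₀ * (ζ₁f t₀) / (ζ t₀)) • mvfderiv 𝓘(ℝ, E) dq x₀ := by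
      ext v
      rw [hdΔφ v, hdQ]
      simp only [FunLike.coe_smul, Pi.smul_apply, smul_eq_mul]
      ring
    have h2 : 2 / (m : ℝ) * Q x₀ ^ 2 + 2 * (Q x₀ * (ζ₁f t₀) / (ζ t₀)) * P - 2 * ((m : ℝ) - 1) * Q x₀ ≤ D := by
      rw [hdΔφ', hΔφ x₀ hρ₀R, ContinuousLinearMap.toLinearMap_smul, innerDual_smul_right'] at hB
      have e : 2 / (m : ℝ) * (-Q x₀) ^ 2 + 2 * (Q x₀ * (ζ₁f t₀) / (ζ t₀) * P) + 2 * -((m : ℝ) - 1) * g.gradSq φ x₀ =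
          2 / (m : ℝ) * Q x₀ ^ 2 + 2 * (Q x₀ * (ζ₁f t₀) / (ζ t₀)) * P - 2 * ((m : ℝ) - 1) * Q x₀ := by
        show 2 / (m : ℝ) * (-Q x₀) ^ 2 + 2 * (Q x₀ * (ζ₁f t₀) / (ζ t₀) * P) + 2 * -((m : ℝ) - 1) * Q x₀ = _
        ring
      linarith only [hB, e]
    -- conclude with the scalar lemma
    have hfin := chengYau_arith hm hQpos hζ₀pos hζ₀1 hR hA₁ hΛ0 hL hζ₁0 hζ₁a hζ₁b hζ₁sq hζ₂ hPb h1 h2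
    calc G x₀ = (ζ t₀) * Q x₀ := by show η x₀ * Q x₀ = (ζ t₀) * Q x₀; rw [hζ₀η]
      _ ≤ C' := hfin

/-- **The Cheng–Yau local gradient estimate** (Cheng–Yau 1975, Thm. 6; Schoen–Yau, Ch. I,
Thm. 3.1): for every `m` there is `C = C(m) ≥ 0` such that on every connected Riemannian
`m`-manifold with complete Levi-Civita connection and `Ric ≥ -(m-1)`, every `C^∞` function
`u > 0` which is harmonic on the ball `B_R(p)` (`Δu = 0` where `d(p, ·) < R`) satisfies
`|∇ log u|²(x) ≤ C (1 + 1/R)²` whenever `d(p, x) ≤ R/2`. [cite: ChengYau1975, Thm. 6]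
[cite: CheegerColding1996, §1] -/
theorem chengYau_gradient_estimate (m : ℕ) : ∃ C : ℝ, 0 ≤ C ∧
    ∀ {E : Type u} [NormedAddCommGroup E] [NormedSpace ℝ E] [FiniteDimensional ℝ E]
      [CompleteSpace E] {M : Type v} [TopologicalSpace M] [ChartedSpace E M]
      [IsManifold 𝓘(ℝ, E) ∞ M] [T2Space M] [ConnectedSpace M]
      (g : PseudoRiemannianMetric 𝓘(ℝ, E) ∞ E (TangentSpace 𝓘(ℝ, E) : M → Type _))
      [g.HasLeviCivita] [CovariantDerivative.ContMDiffCovariantDerivative g.leviCivita 1]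
      [CovariantDerivative.ContMDiffCovariantDerivative g.leviCivita ∞]
      (hg : g.IsRiemannian) (_ : IsGeodesicallyComplete g.leviCivita),
      Module.finrank ℝ E = m →
      (∀ (x : M) (w : TangentSpace 𝓘(ℝ, E) x),
        -((m : ℝ) - 1) * g.val x w w ≤ g.leviCivita.ricci x w w) →
      ∀ (u : M → ℝ), ContMDiff 𝓘(ℝ, E) 𝓘(ℝ, ℝ) ∞ u → (∀ x, 0 < u x) →
      ∀ (p : M) (R : ℝ), 0 < R →
      (∀ x, (g.edist hg p x).toReal < R → g.laplaceBeltrami u x = 0) →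
      ∀ x, (g.edist hg p x).toReal ≤ R / 2 →
        g.gradSq (Real.log ∘ u) x ≤ C * (1 + 1 / R) ^ 2 := by
  obtain ⟨χ, A₁, A₂, hA₁, hA₂, hχs, hχ1, hχ0, hχnn, hχle1, -, hχanti, hχd1, hχd1np, hχd2⟩ :=
    exists_smooth_cutoff_profile
  refine ⟨4 * (m : ℝ) ^ 2 * A₁ ^ 2 + 2 * (m : ℝ) ^ 2 + 8 * m * A₁ ^ 2 + 2 * m * A₂ +
    10 * (m : ℝ) ^ 2 * A₁, by positivity, ?_⟩
  intro E _ _ _ _ M _ _ _ _ _ g _ _ _ hg hc hdim hRic u hu hu0 p R hR hharm x hx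
  rcases Nat.eq_zero_or_pos m with hm0 | hmpos
  · -- dimension zero: the gradient vanishes
    have hE : Module.finrank ℝ E = 0 := by rw [hdim, hm0]
    haveI : Subsingleton E := Module.finrank_zero_iff.1 hE
    haveI : Subsingleton (TangentSpace 𝓘(ℝ, E) x) := inferInstanceAs (Subsingleton E)
    have hQx : g.gradSq (Real.log ∘ u) x = 0 := by
      rw [PseudoRiemannianMetric.gradSq, PseudoRiemannianMetric.innerDual]
      have : g.sharp x (mvfderiv 𝓘(ℝ, E) (Real.log ∘ u) x : TangentSpace 𝓘(ℝ, E) x →ₗ[ℝ] ℝ) = 0 :=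
        Subsingleton.elim _ _
      rw [this, map_zero]
    rw [hQx]; positivity
  exact chengYau_gradient_estimate_core g hg hc hmpos hdim hRic hA₁ hA₂ hχs hχ1 hχ0 hχnn hχle1
    hχanti hχd1 hχd1np hχd2 hu hu0 p hR hharm hx

end Main

end Literature.Geometry.Riemannian

end
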